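import Literature.Computability.AlgebraicComplexity.DDS21BorderDepthThree
import HarnessLib

/-!
# `\overline{ΠΣ} = ΠΣ`: the `k = 1` base of Dutta–Dwivedi–Saxena's de-bordering (proof)

Topic `Literature/Computability/AlgebraicComplexity`; a PROOFS file (D-0014): theorems only, no
definitions, no named facts. It DISCHARGES the named fact `DDS2021_lemma_2_21_piSigma` of
`DDS21BorderDepthThree.lean` (val-lit row X2-DDS21):

  `theorem DDS2021_lemma_2_21_piSigma_holds : DDS2021_lemma_2_21_piSigma`

i.e. a polynomial `f ∈ F[x_1,…,x_n]` approximated, in the sense of DDS Def. 2.1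
(`g = f + ε·Q ∈ F[ε][x]`, `g` a product of `d` affine forms with coefficients in `F(ε)`), by a
`ΠΣ = Σ^{[1]}Π^{[d]}Σ` circuit over `F(ε)` is itself a product of `d` affine forms over `F` — DDS 2021,
§1.1 Remark 1 / §3 proof of Thm. 3.2 ("the `k = 1` case is obvious, as `\overline{ΠΣ} = ΠΣ`"),
quoted there from [24, Prop. A.12].

## The argument (the standard `ε`-adic normalisation; DDS Lemma 2.20's valuation bookkeeping)

Write each affine factor `ℓ_j` (coefficients in `F(ε)`) as `ℓ_j = c_j · ℓ̂_j` with `c_j ∈ F(ε)^×`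
and `ℓ̂_j` with POLYNOMIAL coefficients in `F[ε]` one of which has a nonzero constant term
(`exists_normalize_family`: common denominator, then the least `ε`-adic order of the numerators).
Then `g = c · Ĝ` with `c = ∏ c_j` and `Ĝ = ∏ ℓ̂_j ∈ F[ε][x]`, whose reduction `Ĝ(ε = 0) = ∏ ℓ̂_j(0)` is
a NONZERO product of affine forms over `F` (`F[x]` is a domain). Normalise `c = ε^{a-b} P/Q` with
`P(0), Q(0) ≠ 0` (`exists_normalize_ne_zero`). The approximation hypothesis says every coefficient
`g_e` is a polynomial `p_e ∈ F[ε]` with `p_e(0) = f_e`; hence `p_e · ε^b Q = ε^a P · Ĝ_e` in `F[ε]`.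
If `a < b`, the coefficient `e₀` with `Ĝ_{e₀}(0) ≠ 0` gives a contradiction at `ε = 0`; if `a > b`,
every `p_e(0) = 0`, so `f = 0` (a product with a zero form); if `a = b`, `f = (P(0)/Q(0)) · Ĝ(0)`,
a product of `d` affine forms. The case `d = 0` (`g = 1 = f`) is separate.

Honest framing: an elementary closedness statement (products of affine forms are Zariski closed),
here in the `F(ε)`-algebraic rendering; nothing in this file bears on VP versus VNP, which is NOT
proved.

## References

* [DuttaDwivediSaxena2022] P. Dutta, P. Dwivedi, N. Saxena, *Demystifying the border of depth-3
  algebraic circuits*, FOCS 2021; full version `paper:galaxy-pdf-7641649743695546420`, §1.1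
  Remark 1 (p0006 L140–141), §2.5 Lemma 2.20/2.21 (p0023–p0024), §3 (p0026 L716).
-/

noncomputable section

open MvPolynomial
open scoped BigOperators Polynomial

namespace Literature.Computability.AlgebraicComplexity

namespace DDS2021

/-! ### `ε`-adic normalisation in `F(ε) = RatFunc F` -/

section Normalise

variable {F : Type*} [Field F]

/-- A nonzero polynomial is `X^k · q` with `q(0) ≠ 0` (`k` = its trailing degree). [folklore] -/
private theorem exists_eq_X_pow_mul_coeff_zero_ne_zero (p : F[X]) (hp : p ≠ 0) :
    ∃ (k : ℕ) (q : F[X]), p = Polynomial.X ^ k * q ∧ q.coeff 0 ≠ 0 := by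
  have hdvd : Polynomial.X ^ p.natTrailingDegree ∣ p :=
    Polynomial.X_pow_dvd_iff.mpr fun d hd => Polynomial.coeff_eq_zero_of_lt_natTrailingDegree hd
  obtain ⟨q, hq⟩ := hdvd
  refine ⟨p.natTrailingDegree, q, hq, ?_⟩
  have h := Polynomial.coeff_X_pow_mul q p.natTrailingDegree 0
  rw [zero_add, ← hq] at h
  rw [← h]
  exact Polynomial.trailingCoeff_nonzero_iff_nonzero.mpr hp

/-- **Normalisation of a nonzero rational function**: `c · ε^b Q = ε^a P` with `P(0), Q(0) ≠ 0`
(numerator and denominator split off their `ε`-adic orders; DDS's "`val_ε`" of Lemma 2.19/2.20,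
`val_y(p/q) := val_y(p) − val_y(q)`). [cite: DuttaDwivediSaxena2022, §2 "Valuation" and Lemma 2.20 (proof; full version p0015 L407–410, p0023)] -/
theorem exists_normalize_ne_zero (c : RatFunc F) (hc : c ≠ 0) :
    ∃ (a b : ℕ) (P Q : F[X]), P.coeff 0 ≠ 0 ∧ Q.coeff 0 ≠ 0 ∧
      c * algebraMap F[X] (RatFunc F) (Polynomial.X ^ b * Q) =
        algebraMap F[X] (RatFunc F) (Polynomial.X ^ a * P) := by
  obtain ⟨a, P, hnum, hP⟩ := exists_eq_X_pow_mul_coeff_zero_ne_zero c.num (RatFunc.num_ne_zero hc)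
  obtain ⟨b, Q, hden, hQ⟩ := exists_eq_X_pow_mul_coeff_zero_ne_zero c.denom (RatFunc.denom_ne_zero c)
  refine ⟨a, b, P, Q, hP, hQ, ?_⟩
  have hden0 : algebraMap F[X] (RatFunc F) c.denom ≠ 0 :=
    (map_ne_zero_iff _ (RatFunc.algebraMap_injective F)).mpr (RatFunc.denom_ne_zero c)
  have h := RatFunc.num_div_denom c
  rw [← hnum, ← hden]
  rw [div_eq_iff hden0] at h
  rw [← h]

/-- **Normalisation of a nonzero finite family of rational functions**: a common factor
`c ∈ F(ε)^×` and polynomials `β_o ∈ F[ε]` with `α_o = c · β_o` for all `o`, some `β_o` having a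
nonzero constant term (common denominator, then the least `ε`-adic order among the numerators).
This is the coefficient-level content of DDS's "`val_ε`" bookkeeping (Lemma 2.20, proof).
[cite: DuttaDwivediSaxena2022, Lemma 2.20 (proof; full version p0023)] -/
theorem exists_normalize_family {O : Type*} [Fintype O] [DecidableEq O] (α : O → RatFunc F)
    (hα : α ≠ 0) :
    ∃ (c : RatFunc F) (β : O → F[X]), c ≠ 0 ∧
      (∀ o, α o = c * algebraMap F[X] (RatFunc F) (β o)) ∧ ∃ o, (β o).coeff 0 ≠ 0 := by
  classical
  have hinj := RatFunc.algebraMap_injective F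
  -- common denominator `D` and numerators `P o` with `P o = D · α o`
  set D : F[X] := ∏ o, (α o).denom with hD
  have hD0 : D ≠ 0 := Finset.prod_ne_zero_iff.mpr fun o _ => RatFunc.denom_ne_zero _
  have hDK : algebraMap F[X] (RatFunc F) D ≠ 0 := (map_ne_zero_iff _ hinj).mpr hD0
  set P : O → F[X] := fun o => (α o).num * ∏ o' ∈ Finset.univ.erase o, (α o').denom with hP
  have hPα : ∀ o, algebraMap F[X] (RatFunc F) (P o) = algebraMap F[X] (RatFunc F) D * α o := by
    intro o
    have hden : algebraMap F[X] (RatFunc F) (α o).denom ≠ 0 :=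
      (map_ne_zero_iff _ hinj).mpr (RatFunc.denom_ne_zero _)
    have hsplit : D = (α o).denom * ∏ o' ∈ Finset.univ.erase o, (α o').denom := by
      rw [hD, ← Finset.mul_prod_erase Finset.univ (fun o' => (α o').denom) (Finset.mem_univ o)]
    have hnd := RatFunc.num_div_denom (α o)
    rw [div_eq_iff hden] at hnd
    simp only [hP, map_mul]
    rw [hsplit, map_mul, hnd]
    ring
  -- some numerator is nonzero
  obtain ⟨o₁, ho₁⟩ : ∃ o, α o ≠ 0 := by
    by_contra h
    push Not at h
    exact hα (funext h)
  have hPo₁ : P o₁ ≠ 0 := by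
    intro h0
    have := hPα o₁
    rw [h0, map_zero] at this
    exact (mul_ne_zero hDK ho₁) this.symm
  -- the least trailing degree `a` among the nonzero numerators
  set S : Finset O := Finset.univ.filter fun o => P o ≠ 0 with hS
  have hSne : S.Nonempty := ⟨o₁, by simp [hS, hPo₁]⟩
  obtain ⟨oₘ, hoₘS, hmin⟩ := Finset.exists_min_image S (fun o => (P o).natTrailingDegree) hSne
  have hPoₘ : P oₘ ≠ 0 := by simpa [hS] using hoₘS
  set a : ℕ := (P oₘ).natTrailingDegree with ha
  have hdvd : ∀ o, Polynomial.X ^ a ∣ P o := by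
    intro o
    by_cases h0 : P o = 0
    · rw [h0]; exact dvd_zero _
    · have hle : a ≤ (P o).natTrailingDegree := hmin o (by simp [hS, h0])
      exact Polynomial.X_pow_dvd_iff.mpr fun d hd =>
        Polynomial.coeff_eq_zero_of_lt_natTrailingDegree (lt_of_lt_of_le hd hle)
  choose Q hQ using hdvd
  have hQoₘ : (Q oₘ).coeff 0 ≠ 0 := by
    have h := Polynomial.coeff_X_pow_mul (Q oₘ) a 0
    rw [zero_add, ← hQ oₘ] at h
    rw [← h]
    have ht := Polynomial.trailingCoeff_nonzero_iff_nonzero.mpr hPoₘ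
    rwa [Polynomial.trailingCoeff, ← ha] at ht
  have hXa : algebraMap F[X] (RatFunc F) (Polynomial.X ^ a) ≠ 0 :=
    (map_ne_zero_iff _ hinj).mpr (pow_ne_zero _ Polynomial.X_ne_zero)
  refine ⟨algebraMap F[X] (RatFunc F) (Polynomial.X ^ a) / algebraMap F[X] (RatFunc F) D, Q,
    div_ne_zero hXa hDK, fun o => ?_, ⟨oₘ, hQoₘ⟩⟩
  have h := hPα o
  rw [hQ o, map_mul] at h
  rw [div_mul_eq_mul_div, eq_div_iff hDK]
  linear_combination (-1 : RatFunc F) * h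

end Normalise

/-! ### Coefficients of affine forms `C (β none) + ∑_m C (β (some m)) * X m` -/

section Affine

variable {R S : Type*} [CommSemiring R] [CommSemiring S] {n : ℕ}

/-- The constant coefficient of an affine form. [folklore] -/
private theorem coeff_zero_affine (β : Option (Fin n) → R) :
    coeff 0 (C (β none) + ∑ m, C (β (some m)) * X m : MvPolynomial (Fin n) R) = β none := by
  classical
  rw [coeff_add, coeff_C, if_pos rfl, coeff_sum, Finset.sum_eq_zero, add_zero]
  intro m _
  rw [coeff_C_mul, coeff_X, if_neg (Finsupp.single_ne_zero.mpr one_ne_zero), mul_zero]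

/-- The coefficient of `x_m` of an affine form. [folklore] -/
private theorem coeff_single_affine (β : Option (Fin n) → R) (m : Fin n) :
    coeff (Finsupp.single m 1) (C (β none) + ∑ m, C (β (some m)) * X m : MvPolynomial (Fin n) R) =
      β (some m) := by
  classical
  rw [coeff_add, coeff_C, if_neg (Finsupp.single_ne_zero.mpr one_ne_zero).symm, zero_add,
    coeff_sum, Finset.sum_eq_single m]
  · rw [coeff_C_mul, coeff_X, if_pos rfl, mul_one]
  · intro m' _ hm'
    rw [coeff_C_mul, coeff_X, if_neg, mul_zero]
    intro h
    exact hm' (Finsupp.single_left_injective one_ne_zero h)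
  · intro h; exact absurd (Finset.mem_univ m) h

/-- An affine form with a nonzero coefficient is nonzero. [folklore] -/
private theorem affine_ne_zero {β : Option (Fin n) → R} (h : ∃ o, β o ≠ 0) :
    (C (β none) + ∑ m, C (β (some m)) * X m : MvPolynomial (Fin n) R) ≠ 0 := by
  obtain ⟨o, ho⟩ := h
  intro h0
  cases o with
  | none => exact ho (by rw [← coeff_zero_affine β, h0, coeff_zero])
  | some m => exact ho (by rw [← coeff_single_affine β m, h0, coeff_zero])

/-- Ring homomorphisms act coefficientwise on affine forms. [folklore] -/
private theorem map_affine (φ : R →+* S) (β : Option (Fin n) → R) :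
    map φ (C (β none) + ∑ m, C (β (some m)) * X m : MvPolynomial (Fin n) R) =
      C (φ (β none)) + ∑ m, C (φ (β (some m))) * X m := by
  simp only [map_add, map_sum, map_mul, map_C, map_X]

/-- Scaling an affine form scales its coefficients. [folklore] -/
private theorem C_mul_affine (c : R) (β : Option (Fin n) → R) :
    C c * (C (β none) + ∑ m, C (β (some m)) * X m : MvPolynomial (Fin n) R) =
      C (c * β none) + ∑ m, C (c * β (some m)) * X m := by
  rw [mul_add, ← C_mul, Finset.mul_sum]
  refine congrArg _ (Finset.sum_congr rfl fun m _ => ?_)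
  rw [← mul_assoc, ← C_mul]

end Affine

/-! ### The approximation hypothesis, coefficientwise -/

section Approx

variable {F : Type*} [Field F] {n : ℕ}

/-- Unfolding `MS2021.IsEpsApprox` for the same number of variables: every coefficient of `g` is a
polynomial in `ε` with constant term the corresponding coefficient of `f`. [folklore] -/
private theorem coeff_of_isEpsApprox {f : MvPolynomial (Fin n) F} {g : MvPolynomial (Fin n) (RatFunc F)}
    (h : MS2021.IsEpsApprox f g) (e : Fin n →₀ ℕ) :
    ∃ p : F[X], coeff e g = algebraMap F[X] (RatFunc F) p ∧ p.coeff 0 = coeff e f := by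
  obtain ⟨hle, h⟩ := h
  obtain ⟨p, hp, hp0⟩ := h e
  refine ⟨p, hp, ?_⟩
  rw [hp0]
  have hid : (Fin.castLE hle : Fin n → Fin n) = id := funext fun i => by simp
  rw [hid, rename_id]
  rfl

end Approx

end DDS2021

open DDS2021

/-! ### The discharge -/

/-- **`\overline{ΠΣ} = ΠΣ` (DDS 2021, §1.1 Remark 1 / the `k = 1` base of Thm. 3.2, from
[24, Prop. A.12]) — PROVED**: a polynomial approximated over `F(ε)` by a product of `d` affine
forms is a product of `d` affine forms over `F`. Discharges the named fact
`DDS2021_lemma_2_21_piSigma`. [cite: DuttaDwivediSaxena2022, §1.1 Remark 1 and §3 proof of Thm. 3.2 (full version p0006 L140–141, p0026 L716)] -/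
theorem DDS2021_lemma_2_21_piSigma_holds : DDS2021_lemma_2_21_piSigma := by
  intro F _ _ n d f hf
  classical
  obtain ⟨g, hg𝒞, happ⟩ := hf
  obtain ⟨α, hgα⟩ : MS2021.IsSPS 1 d g := hg𝒞
  have hinj := RatFunc.algebraMap_injective F
  have hcoef := coeff_of_isEpsApprox happ
  rw [Fin.sum_univ_one] at hgα
  -- goal: `f` is a single product of `d` affine forms
  change MS2021.IsSPS 1 d f
  -- Case `d = 0`: `g = 1 = f`.
  rcases Nat.eq_zero_or_pos d with hd | hd
  · subst hd
    refine ⟨fun _ j _ => Fin.elim0 j, ?_⟩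
    rw [Fin.sum_univ_one, Finset.univ_eq_empty, Finset.prod_empty]
    rw [Finset.univ_eq_empty, Finset.prod_empty] at hgα
    ext e
    obtain ⟨p, hp, hp0⟩ := hcoef e
    rw [hgα, coeff_one] at hp
    have hpe : p = if 0 = e then 1 else 0 := by
      apply hinj
      rw [← hp]
      split_ifs <;> simp
    rw [← hp0, hpe, coeff_one]
    split_ifs <;> simp
  -- from now on `d ≥ 1`
  obtain ⟨d, rfl⟩ : ∃ d', d = d' + 1 := ⟨d - 1, by omega⟩
  -- `f = 0` is a product of `d + 1` zero forms
  have hzero : f = 0 → MS2021.IsSPS 1 (d + 1) f := by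
    intro hf0
    refine ⟨fun _ _ _ => 0, ?_⟩
    rw [hf0, Fin.sum_univ_one, eq_comm]
    apply Finset.prod_eq_zero (Finset.mem_univ (0 : Fin (d + 1)))
    simp
  -- Case: some factor is the zero form ⇒ `g = 0` ⇒ `f = 0`.
  by_cases hsome : ∃ j, α 0 j = 0
  · obtain ⟨j, hj⟩ := hsome
    have hg0 : g = 0 := by
      rw [hgα]
      apply Finset.prod_eq_zero (Finset.mem_univ j)
      simp [hj]
    apply hzero
    ext e
    obtain ⟨p, hp, hp0⟩ := hcoef e
    rw [hg0, coeff_zero, eq_comm, map_eq_zero_iff _ hinj] at hp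
    rw [← hp0, hp, Polynomial.coeff_zero, coeff_zero]
  push Not at hsome
  -- Normalise every factor: `α 0 j o = c j * β j o`, `β j o ∈ F[ε]`, some `β j o` with unit constant term.
  choose c β hc hαβ hβ using fun j => exists_normalize_family (α 0 j) (hsome j)
  -- the integral model `Ĝ = ∏_j ℓ(β j)` and its reduction `∏_j ℓ(β j (0))`
  set Ghat : MvPolynomial (Fin n) F[X] :=
    ∏ j, (C (β j none) + ∑ m, C (β j (some m)) * X m) with hGhat
  set red : MvPolynomial (Fin n) F :=
    ∏ j, (C ((β j none).coeff 0) + ∑ m, C ((β j (some m)).coeff 0) * X m) with hred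
  have hred_map : map (Polynomial.constantCoeff : F[X] →+* F) Ghat = red := by
    rw [hGhat, map_prod]
    refine Finset.prod_congr rfl fun j _ => ?_
    rw [map_affine]
    rfl
  have hred_ne : red ≠ 0 := by
    rw [hred]
    refine Finset.prod_ne_zero_iff.mpr fun j _ =>
      affine_ne_zero (β := fun o => (β j o).coeff 0) ?_
    obtain ⟨o, ho⟩ := hβ j
    exact ⟨o, ho⟩
  -- `g = C (∏ c j) * map Ĝ`
  have hgK : g = C (∏ j, c j) * map (algebraMap F[X] (RatFunc F)) Ghat := by
    rw [hgα, hGhat, map_prod (map (algebraMap F[X] (RatFunc F))), map_prod C,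
      ← Finset.prod_mul_distrib]
    refine Finset.prod_congr rfl fun j _ => ?_
    rw [map_affine, C_mul_affine (c j) (fun o => algebraMap F[X] (RatFunc F) (β j o))]
    congr 1
    · rw [hαβ j none]
    · refine Finset.sum_congr rfl fun m _ => ?_
      rw [hαβ j (some m)]
  have hcc : (∏ j, c j) ≠ 0 := Finset.prod_ne_zero_iff.mpr fun j _ => hc j
  obtain ⟨a, b, P, Q, hP, hQ, hPQ⟩ := exists_normalize_ne_zero (∏ j, c j) hcc
  -- the coefficient identity `p_e · X^b Q = X^a P · Ĝ_e` in `F[ε]`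
  have key : ∀ e, ∃ p : F[X], p.coeff 0 = coeff e f ∧
      p * (Polynomial.X ^ b * Q) = Polynomial.X ^ a * P * coeff e Ghat := by
    intro e
    obtain ⟨p, hp, hp0⟩ := hcoef e
    refine ⟨p, hp0, hinj ?_⟩
    rw [map_mul, ← hp, hgK, coeff_C_mul, coeff_map, mul_assoc, mul_comm (algebraMap _ _ (coeff e Ghat)),
      ← mul_assoc, hPQ, map_mul, map_mul, map_mul]
  -- a coefficient of `Ĝ` with nonzero constant term
  obtain ⟨e₀, he₀⟩ : ∃ e, (coeff e Ghat).coeff 0 ≠ 0 := by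
    by_contra h
    push Not at h
    apply hred_ne
    rw [← hred_map]
    ext e
    rw [coeff_map, coeff_zero]
    exact h e
  rcases lt_trichotomy a b with hab | hab | hab
  · -- `a < b`: contradiction at `e₀`
    exfalso
    obtain ⟨p, -, hpe⟩ := key e₀
    obtain ⟨k, hk⟩ : ∃ k, b = a + (k + 1) := ⟨b - a - 1, by omega⟩
    have h1 : Polynomial.X ^ a * (p * Polynomial.X ^ (k + 1) * Q) =
        Polynomial.X ^ a * (P * coeff e₀ Ghat) := by
      rw [hk, pow_add] at hpe
      linear_combination hpe
    have h2 := mul_left_cancel₀ (pow_ne_zero a Polynomial.X_ne_zero) h1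
    have h0 := congrArg (fun q : F[X] => q.coeff 0) h2
    simp only [Polynomial.mul_coeff_zero, Polynomial.coeff_X_pow, pow_succ,
      Polynomial.coeff_X_zero, mul_zero, zero_mul] at h0
    exact (mul_ne_zero hP he₀) (by simpa using h0.symm)
  · -- `a = b`: `f = (P(0)/Q(0)) · red`
    subst hab
    have hcoeff : ∀ e, coeff e f = (P.coeff 0 / Q.coeff 0) * coeff e red := by
      intro e
      obtain ⟨p, hp0, hpe⟩ := key e
      have h1 : Polynomial.X ^ a * (p * Q) = Polynomial.X ^ a * (P * coeff e Ghat) := by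
        linear_combination hpe
      have h2 := mul_left_cancel₀ (pow_ne_zero a Polynomial.X_ne_zero) h1
      have h0 := congrArg (fun q : F[X] => q.coeff 0) h2
      simp only [Polynomial.mul_coeff_zero] at h0
      rw [← hp0, ← hred_map, coeff_map, Polynomial.constantCoeff_apply]
      field_simp
      linear_combination h0
    have hf : f = C (P.coeff 0 / Q.coeff 0) * red := by
      ext e
      rw [hcoeff e, coeff_C_mul]
    -- absorb the scalar into the factor `j = 0`
    refine ⟨fun _ j o => if j = 0 then (P.coeff 0 / Q.coeff 0) * (β j o).coeff 0
      else (β j o).coeff 0, ?_⟩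
    rw [Fin.sum_univ_one, hf, hred, Fin.prod_univ_succ, Fin.prod_univ_succ, ← mul_assoc]
    -- (`congr 1` closes the factors `j.succ`, whose `if j.succ = 0` reduces definitionally)
    congr 1
    rw [C_mul_affine (P.coeff 0 / Q.coeff 0) (fun o => (β 0 o).coeff 0)]
    simp
  · -- `b < a`: every `p_e(0) = 0`, so `f = 0`
    apply hzero
    ext e
    obtain ⟨p, hp0, hpe⟩ := key e
    obtain ⟨k, hk⟩ : ∃ k, a = b + (k + 1) := ⟨a - b - 1, by omega⟩
    have h1 : Polynomial.X ^ b * (p * Q) =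
        Polynomial.X ^ b * (Polynomial.X ^ (k + 1) * P * coeff e Ghat) := by
      rw [hk, pow_add] at hpe
      linear_combination hpe
    have h2 := mul_left_cancel₀ (pow_ne_zero b Polynomial.X_ne_zero) h1
    have h0 := congrArg (fun q : F[X] => q.coeff 0) h2
    simp only [Polynomial.mul_coeff_zero, Polynomial.coeff_X_pow, pow_succ,
      Polynomial.coeff_X_zero, mul_zero, zero_mul] at h0
    rw [coeff_zero, ← hp0]
    have h0' : p.coeff 0 * Q.coeff 0 = 0 := by simpa using h0
    exact (mul_eq_zero.mp h0').resolve_right hQ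

end Literature.Computability.AlgebraicComplexity

end
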